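import Literature.Dynamics.SymbolicDynamics.Hochman2025Certificates
import HarnessLib

/-!
# Hochman 2025, §6.3: assigning symbols at the witnesses of a glued frame

Two ways of choosing the symbols of the glued configuration `z` at the (free) sites of the
witnesses of a frame so that its coin-and-bucket configuration `CBC(z, F)` (§5.6) is
unorientable (M. Hochman, *Irreducibility and periodicity in `ℤ²` symbolic systems*, Discrete
Analysis 2025:17, §6.3):

* **Relocated frames** (Steps A–B, last paragraph of Step A: "we imagine witnesses moved one at
  a time and set `π_{(θ(w),σ(w))}(z_{w'})` to `H` or `T` according to the strategy in the
  coin-and-bucket game, started from `CBC(x, F)`"): `seqConf` processes the boxes in order; when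
  box `s` was moved, its coin is re-inserted at its new slot with the MINORITY orientation of the
  destination bucket of the current configuration. Each step is a legal move
  (`isUnorientable_cbc_relocate` of `Hochman2025Gluing.lean`), so unorientability is preserved
  (`isUnorientable_seqConf`); the symbols of unmoved coins are untouched
  (`seqConf_apply_orig`).
* **New frames** (Step C: "we can define `π(z_w)` to get any coin-and-bucket configuration we
  could want. We choose an unorientable one"; and Lemma 5.8): with `Nₙ = kₙ 2^{kₙ+1}` coins some
  bucket holds `≥ 2^{kₙ+1}` of them (pigeonhole); showing heads on exactly `2^{kₙ}` of those makes
  the configuration unorientable whatever the other coins show (`Frame.bval`,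
  `Frame.isUnorientable_of_bval`, via `CoinsAndBuckets.not_isOriented_of_big_bucket`).

## References

* [Hochman2025] M. Hochman, op. cit., §6.3 Step A (last paragraph), Step C (last paragraph),
  Lemma 5.8. Read via `lit read arxiv:2401.02273`.
-/

noncomputable section

open Finset

namespace Literature.Dynamics.SymbolicDynamics

namespace Hochman2025

/-! ### Sequential relocation of the coins of a frame -/

section Seq

variable {C : Type*} [DecidableEq C] {n k N : ℕ} (e : (ZMod n × ZMod n) × C ≃ Fin k)
  (base : ℤ × ℤ → C → Bool) (orig fin : Fin N → (ℤ × ℤ) × C) (Moved : Fin N → Prop)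
  [DecidablePred Moved]

/-- The other coins when box `j` is processed: the already processed ones at their final slots,
the later ones at their original slots. [cite: Hochman2025, §6.3 Step A ("witnesses moved one at a time")] -/
def others (j : Fin N) : Finset ((ℤ × ℤ) × C) :=
  (univ.filter fun j' => j' < j).image fin ∪ (univ.filter fun j' => j < j').image orig

/-- The coins after `s` boxes have been processed. [cite: Hochman2025, §6.3 Step A] -/
def coinSet (s : ℕ) : Finset ((ℤ × ℤ) × C) :=
  (univ.filter fun j : Fin N => (j : ℕ) < s).image fin ∪ (univ.filter fun j : Fin N => s ≤ (j : ℕ)).image orig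

/-- **The configuration after `s` boxes have been processed**: the coin of a moved box is given,
at its new slot, the minority orientation of its destination bucket at that time.
[cite: Hochman2025, §6.3 Step A ("set ... according to the strategy in the coin-and-bucket game")] -/
def seqConf : ℕ → (ℤ × ℤ → C → Bool)
  | 0 => base
  | s + 1 => fun p c =>
    if h : s < N then
      if Moved ⟨s, h⟩ ∧ (p, c) = fin ⟨s, h⟩ then
        decide ((cbc e (seqConf s) (others orig fin ⟨s, h⟩)).heads (e (label n (fin ⟨s, h⟩))) ≤
          (cbc e (seqConf s) (others orig fin ⟨s, h⟩)).tails (e (label n (fin ⟨s, h⟩))))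
      else seqConf s p c
    else seqConf s p c

variable {orig fin Moved}

/-- Initially all coins are at their original slots. [folklore] -/
theorem coinSet_zero : coinSet orig fin 0 = univ.image orig := by
  unfold coinSet
  have h1 : (univ.filter fun j : Fin N => (j : ℕ) < 0) = ∅ := by ext j; simp
  have h2 : (univ.filter fun j : Fin N => 0 ≤ (j : ℕ)) = univ := by ext j; simp
  rw [h1, h2, image_empty, empty_union]

/-- Finally all coins are at their final slots. [folklore] -/
theorem coinSet_of_le {s : ℕ} (hs : N ≤ s) : coinSet orig fin s = univ.image fin := by
  unfold coinSet
  have h1 : (univ.filter fun j : Fin N => (j : ℕ) < s) = univ := by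
    ext j; simp only [mem_filter, mem_univ, true_and, iff_true]; exact lt_of_lt_of_le j.2 hs
  have h2 : (univ.filter fun j : Fin N => s ≤ (j : ℕ)) = ∅ := by
    ext j; simp only [mem_filter, mem_univ, true_and, notMem_empty, iff_false, not_le]
    exact lt_of_lt_of_le j.2 hs
  rw [h1, h2, image_empty, union_empty]

/-- Before processing box `s`: its coin at the original slot, plus the others. [folklore] -/
theorem coinSet_eq_insert_orig {s : ℕ} (h : s < N) :
    coinSet orig fin s = insert (orig ⟨s, h⟩) (others orig fin ⟨s, h⟩) := by
  ext w
  simp only [coinSet, others, mem_union, mem_image, mem_filter, mem_univ, true_and, mem_insert]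
  constructor
  · rintro (⟨j, hj, rfl⟩ | ⟨j, hj, rfl⟩)
    · exact Or.inr (Or.inl ⟨j, Fin.lt_def.mpr hj, rfl⟩)
    · rcases (Nat.lt_or_eq_of_le hj) with hlt | heq
      · exact Or.inr (Or.inr ⟨j, Fin.lt_def.mpr hlt, rfl⟩)
      · left
        have : j = ⟨s, h⟩ := Fin.ext heq.symm
        rw [this]
  · rintro (rfl | ⟨j, hj, rfl⟩ | ⟨j, hj, rfl⟩)
    · exact Or.inr ⟨⟨s, h⟩, le_rfl, rfl⟩
    · exact Or.inl ⟨j, Fin.lt_def.mp hj, rfl⟩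
    · exact Or.inr ⟨j, (Fin.lt_def.mp hj).le, rfl⟩

/-- After processing box `s`: its coin at the final slot, plus the others. [folklore] -/
theorem coinSet_succ_eq_insert_fin {s : ℕ} (h : s < N) :
    coinSet orig fin (s + 1) = insert (fin ⟨s, h⟩) (others orig fin ⟨s, h⟩) := by
  ext w
  simp only [coinSet, others, mem_union, mem_image, mem_filter, mem_univ, true_and, mem_insert]
  constructor
  · rintro (⟨j, hj, rfl⟩ | ⟨j, hj, rfl⟩)
    · rcases (Nat.lt_or_eq_of_le (Nat.lt_succ_iff.mp hj)) with hlt | heq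
      · exact Or.inr (Or.inl ⟨j, Fin.lt_def.mpr hlt, rfl⟩)
      · left
        have : j = ⟨s, h⟩ := Fin.ext heq
        rw [this]
    · exact Or.inr (Or.inr ⟨j, Fin.lt_def.mpr (Nat.lt_of_succ_le hj), rfl⟩)
  · rintro (rfl | ⟨j, hj, rfl⟩ | ⟨j, hj, rfl⟩)
    · exact Or.inl ⟨⟨s, h⟩, Nat.lt_succ_self s, rfl⟩
    · exact Or.inl ⟨j, Nat.lt_succ_of_lt (Fin.lt_def.mp hj), rfl⟩
    · exact Or.inr ⟨j, Nat.succ_le_of_lt (Fin.lt_def.mp hj), rfl⟩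

variable (hdis : ∀ j j' : Fin N, j ≠ j' → orig j ≠ orig j' ∧ fin j ≠ fin j' ∧ orig j ≠ fin j')
include hdis

/-- The original slot of a box is not among the other coins. [folklore] -/
theorem orig_not_mem_others (j : Fin N) : orig j ∉ others orig fin j := by
  simp only [others, mem_union, mem_image, mem_filter, mem_univ, true_and, not_or, not_exists, not_and]
  constructor
  · intro j' hj' h; exact (hdis j j' (ne_of_gt hj')).2.2 h.symm
  · intro j' hj' h; exact (hdis j' j (ne_of_gt hj')).1 h

/-- The final slot of a box is not among the other coins. [folklore] -/
theorem fin_not_mem_others (j : Fin N) : fin j ∉ others orig fin j := by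
  simp only [others, mem_union, mem_image, mem_filter, mem_univ, true_and, not_or, not_exists, not_and]
  constructor
  · intro j' hj' h; exact (hdis j' j (ne_of_lt hj')).2.1 h
  · intro j' hj' h; exact (hdis j' j (ne_of_gt hj')).2.2 h

omit hdis in
/-- A step only changes the symbol at the final slot of a moved box. [folklore] -/
theorem seqConf_succ_apply {s : ℕ} (p : ℤ × ℤ) (c : C)
    (hpc : ∀ h : s < N, Moved ⟨s, h⟩ → (p, c) ≠ fin ⟨s, h⟩) :
    seqConf e base orig fin Moved (s + 1) p c = seqConf e base orig fin Moved s p c := by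
  simp only [seqConf]
  split_ifs with h h2
  · exact absurd h2.2 (hpc h h2.1)
  · rfl
  · rfl

omit hdis in
/-- The symbol given to a moved coin is the minority orientation of its destination bucket.
[cite: Hochman2025, §6.3 Step A] -/
theorem seqConf_succ_fin {s : ℕ} (h : s < N) (hm : Moved ⟨s, h⟩) :
    seqConf e base orig fin Moved (s + 1) (fin ⟨s, h⟩).1 (fin ⟨s, h⟩).2 =
      decide ((cbc e (seqConf e base orig fin Moved s) (others orig fin ⟨s, h⟩)).heads (e (label n (fin ⟨s, h⟩))) ≤
        (cbc e (seqConf e base orig fin Moved s) (others orig fin ⟨s, h⟩)).tails (e (label n (fin ⟨s, h⟩)))) := by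
  simp only [seqConf, h, dif_pos, hm, Prod.mk.eta, and_self, if_true]

/-- **Unorientability is preserved along the sequential relocation.**
[cite: Hochman2025, §6.3 Step A ("We again define `z` at the sites `w'` ... so as to restore compatibility")] -/
theorem isUnorientable_seqConf (hfix : ∀ j, ¬ Moved j → fin j = orig j)
    (h0 : CoinsAndBuckets.IsUnorientable (cbc e base (univ.image orig))) (s : ℕ) :
    CoinsAndBuckets.IsUnorientable (cbc e (seqConf e base orig fin Moved s) (coinSet orig fin s)) := by
  induction s with
  | zero => rw [coinSet_zero]; exact h0
  | succ s ih =>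
    by_cases h : s < N
    · set j : Fin N := ⟨s, h⟩ with hj
      rw [coinSet_eq_insert_orig h] at ih
      rw [coinSet_succ_eq_insert_fin h]
      by_cases hm : Moved j
      · refine isUnorientable_cbc_relocate e (orig_not_mem_others hdis j) (fin_not_mem_others hdis j)
          (fun w hw => seqConf_succ_apply e base w.1 w.2 fun h' _ => ?_) (seqConf_succ_fin e base h hm) ih
        intro heq
        have : w = fin ⟨s, h'⟩ := by rw [← heq]
        exact fin_not_mem_others hdis _ (this ▸ hw)
      · have hconf : seqConf e base orig fin Moved (s + 1) = seqConf e base orig fin Moved s := by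
          funext p c
          exact seqConf_succ_apply e base p c fun h' hm' => absurd hm' (by convert hm)
        rw [hconf, hfix j hm]
        exact ih
    · have hconf : seqConf e base orig fin Moved (s + 1) = seqConf e base orig fin Moved s := by
        funext p c
        exact seqConf_succ_apply e base p c fun h' _ => absurd h' h
      push Not at h
      rw [hconf, coinSet_of_le (Nat.le_succ_of_le h)]
      rw [coinSet_of_le h] at ih
      exact ih

/-- **Unmoved coins keep their symbol.** [cite: Hochman2025, §6.3 Step A (1)] -/
theorem seqConf_apply_orig {j : Fin N} (hj : ¬ Moved j) (s : ℕ) :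
    seqConf e base orig fin Moved s (orig j).1 (orig j).2 = base (orig j).1 (orig j).2 := by
  induction s with
  | zero => rfl
  | succ s ih =>
    rw [seqConf_succ_apply e base, ih]
    intro h hm heq
    have hne : (⟨s, h⟩ : Fin N) ≠ j := fun heq' => hj (heq' ▸ hm)
    exact (hdis j ⟨s, h⟩ (Ne.symm hne)).2.2 (by rw [← heq])

end Seq

/-! ### Symbols for a frame with prescribed buckets (Lemma 5.8 / Step C) -/

namespace Frame

variable {P : Params} {m : ℕ} (F : Frame P (m + 1))

/-- The coin of box `j` (site relative to the centre, class). [cite: Hochman2025, §5.6] -/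
def coinOf (j : Fin (P.N (m + 1))) : (ℤ × ℤ) × Cls P := (Plane.site (F.w j) - F.z, (F.k, F.σ j))

/-- The coins of the frame are the coins of its boxes. [folklore] -/
theorem coins_eq_image : F.coins = univ.image F.coinOf := rfl

/-- The bucket of box `j`. [cite: Hochman2025, §5.6] -/
def bucketOf (j : Fin (P.N (m + 1))) : Fin (P.buckets (m + 1)) :=
  bucketsEquiv P (m + 1) (label (m + 1) (F.coinOf j))

/-- **Pigeonhole**: a fullest bucket holds `≥ 2^{k+1}` of the `k 2^{k+1}` coins. [cite: Hochman2025, §5.2 and Lemma 5.8] -/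
theorem exists_bigBucket (hP : P.Good) :
    ∃ b : Fin (P.buckets (m + 1)), 2 ^ (P.buckets (m + 1) + 1) ≤ (univ.filter fun j => F.bucketOf j = b).card := by
  have hb : 0 < P.buckets (m + 1) := by
    unfold Params.buckets
    have hT : 0 < P.T := lt_of_lt_of_le (by norm_num) hP.T_le
    have hS : 0 < P.S := lt_of_lt_of_le (by norm_num) hP.S_le
    positivity
  haveI : Nonempty (Fin (P.buckets (m + 1))) := ⟨⟨0, hb⟩⟩
  have hcard : Fintype.card (Fin (P.buckets (m + 1))) * 2 ^ (P.buckets (m + 1) + 1) ≤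
      Fintype.card (Fin (P.N (m + 1))) := by
    rw [Fintype.card_fin, Fintype.card_fin]
    unfold Params.N
    exact le_rfl
  have := Fintype.exists_le_card_fiber_of_mul_le_card F.bucketOf hcard
  simpa using this

/-- A fullest bucket. [folklore] -/
def bstar (hP : P.Good) : Fin (P.buckets (m + 1)) := Classical.choose (F.exists_bigBucket hP)

/-- The boxes whose coin lies in the fullest bucket. [folklore] -/
def fiber (hP : P.Good) : Finset (Fin (P.N (m + 1))) := univ.filter fun j => F.bucketOf j = F.bstar hP

/-- The fullest bucket is big. [folklore] -/
theorem fiber_card (hP : P.Good) : 2 ^ (P.buckets (m + 1) + 1) ≤ (F.fiber hP).card :=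
  Classical.choose_spec (F.exists_bigBucket hP)

/-- `2^k` boxes of the fullest bucket (their coins will show heads). [folklore] -/
def headsF (hP : P.Good) : Finset (Fin (P.N (m + 1))) :=
  Classical.choose (Finset.exists_subset_card_eq (s := F.fiber hP) (n := 2 ^ P.buckets (m + 1))
    (le_trans (Nat.pow_le_pow_right (by norm_num) (Nat.le_succ _)) (F.fiber_card hP)))

/-- Properties of `headsF`. [folklore] -/
theorem headsF_spec (hP : P.Good) : F.headsF hP ⊆ F.fiber hP ∧ (F.headsF hP).card = 2 ^ P.buckets (m + 1) :=
  Classical.choose_spec (Finset.exists_subset_card_eq (s := F.fiber hP) (n := 2 ^ P.buckets (m + 1))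
    (le_trans (Nat.pow_le_pow_right (by norm_num) (Nat.le_succ _)) (F.fiber_card hP)))

/-- **The prescribed symbols of the coins of a new frame**: heads exactly on `headsF`.
[cite: Hochman2025, §6.3 Step C ("We choose an unorientable one")] -/
def bval (hP : P.Good) (j : Fin (P.N (m + 1))) : Bool := decide (j ∈ F.headsF hP)

/-- **A configuration showing the prescribed symbols at the witnesses of the frame is compatible
with it** (the fullest bucket shows `2^k` heads and `≥ 2^k` tails). [cite: Hochman2025, Lemma 5.8 and §6.3 Step C] -/
theorem isUnorientable_of_bval (hP : P.Good) (hinj : Function.Injective F.coinOf)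
    (z : ℤ × ℤ → Cls P → Bool) (hz : ∀ j, z (Plane.site (F.w j)) (F.k, F.σ j) = F.bval hP j) :
    CoinsAndBuckets.IsUnorientable (F.cbcF z) := by
  classical
  have hval : ∀ j, z ((F.coinOf j).1 + F.z) (F.coinOf j).2 = decide (j ∈ F.headsF hP) := by
    intro j
    simp only [coinOf, sub_add_cancel]
    exact hz j
  have hH : (F.cbcF z).heads (F.bstar hP) =
      (univ.filter fun j => F.bucketOf j = F.bstar hP ∧ j ∈ F.headsF hP).card := by
    simp only [Frame.cbcF, cbc, coins_eq_image, Finset.filter_image, Finset.card_image_of_injective _ hinj]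
    congr 1
    ext j
    simp only [Finset.mem_filter, Finset.mem_univ, true_and, bucketOf, hval, decide_eq_true_eq]
  have hT : (F.cbcF z).tails (F.bstar hP) =
      (univ.filter fun j => F.bucketOf j = F.bstar hP ∧ j ∉ F.headsF hP).card := by
    simp only [Frame.cbcF, cbc, coins_eq_image, Finset.filter_image, Finset.card_image_of_injective _ hinj]
    congr 1
    ext j
    simp only [Finset.mem_filter, Finset.mem_univ, true_and, bucketOf, hval, decide_eq_false_iff_not]
  obtain ⟨hsub, hcard⟩ := F.headsF_spec hP
  have hfib := F.fiber_card hP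
  intro c' hc'
  refine CoinsAndBuckets.not_isOriented_of_big_bucket (F.bstar hP) ?_ ?_ hc'
  · rw [hH]
    have : (univ.filter fun j => F.bucketOf j = F.bstar hP ∧ j ∈ F.headsF hP) = F.headsF hP := by
      ext j
      simp only [Finset.mem_filter, Finset.mem_univ, true_and, and_iff_right_iff_imp]
      intro hj
      have := hsub hj
      simpa [fiber] using this
    rw [this, hcard]
  · rw [hT]
    have : (univ.filter fun j => F.bucketOf j = F.bstar hP ∧ j ∉ F.headsF hP) = F.fiber hP \ F.headsF hP := by
      ext j
      simp [fiber]
    rw [this, Finset.card_sdiff_of_subset hsub, hcard]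
    have : 2 ^ (P.buckets (m + 1) + 1) = 2 ^ P.buckets (m + 1) + 2 ^ P.buckets (m + 1) := by ring
    omega

end Frame

end Hochman2025

end Literature.Dynamics.SymbolicDynamics
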